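import Summits.RiemannHypothesis.RiemannHypothesis.Theorems.PfPersistenceSecondLevelWalls
import HarnessLib

/-!
# PF persistence — ARRIVAL-ONLY ACCEPTANCE: a sign-blind RATIO conjunct rejects a negative member at every
window where `ζ` has a 2-cluster below the member's downward push
(pub-rhpf barrier-prover gen 5; CASE-DAG leaf G1.21b / §6 PINCER `(Z)`-cell; cand-11 instruments I1/I3)

**HONEST FRAMING. This is a long-odds MECHANISM / RIGIDITY campaign; no RH claims.** Everything below is RH-free
linear algebra on the cell's window matrices plus bookkeeping in the dial space; `ζ`'s Weil positivity is never
assumed or concluded. Labels: PROVED = kernel-checked here; the numerical inputs named in the docstrings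
(`ζ`'s 2-cluster height `η₂(w)`, a member's push `p`, `c` on that cluster) are per-window BINDERS, to be certified by
the engines (DATA) — they are hypotheses of the theorems, not claims.

## What the leaf asks (CASE-DAG G1.21b, census 2026-08-19)

After the `R1`-type readers (`u₁`, nodal side, entry ratios) were walled or found unsound, the surviving G1
conjuncts are SIGN-BLIND RATIOS of the bottom of the window spectrum to its own cluster scale:
`|ε₁(d; w)| ≤ τ · (ε₂ − ε₁)(d; w)` (gauge ratio, "the bottom sits within `τ` of the cluster scale") and
`|ε₁(d; w)| ≤ κ · |ε₂(d; w)|` (modulus ratio, cand-11's `g₁ = 1 − |ε₁/ε₂| ≥ 1 − κ`). DATA (cand-11, ctrl engines):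
the negative dials that such conjuncts ACCEPT are accepted only "at arrival" — in a short range of windows where the
member has just turned negative — and are REJECTED at every deeper window. This file proves the structural reason
and types the residue.

## What is proved

* §1 `secondRayleigh_le_of_plane` — PLANE CAP (upper half of Courant–Fischer for `k = 2`, witness form): a plane
  on which the Rayleigh quotient is `≤ B` forces `ε₂ ≤ B`. No symmetry, no eigen-decomposition.
* §2 `mul_gauge_lt_abs_bottom`, `mul_abs_second_lt_abs_bottom` — RATIO REJECTION (matrix level): an `m`-negative
  matrix with a plane of height `≤ B` violates the gauge-ratio conjunct as soon as `τ B < m (1 − τ)`, and the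
  modulus-ratio conjunct as soon as `κ B < m`.
* §3 `mul_gauge_lt_abs_bottom_of_push` — the same against a REFERENCE matrix `Z` (`ζ`'s window matrix) with a
  2-cluster plane of height `η₂`: a push capped above by `c` on that plane and `≥ p` downward on one vector of
  `ζ`-height `η` is rejected whenever `τ (η₂ + c) < (p − η)(1 − τ)`.
* §4 `gaugeRatioAt`, `modulusRatioAt` (the conjuncts as classes of data at a window) and
  `dial_not_mem_gaugeRatioAt`, `dial_not_mem_modulusRatioAt` — the DIAL INSTANCE: the `q`-dial `K` moves `ζ`'s block
  by `−t·Θ_q`, `t = 2(K − 1) w(q)` (`evenBlock_dial_eq`); the binders become pattern values on `ζ`'s cluster plane.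
* §5 `dial_not_mem_of_subset_gaugeRatioAt` — AS-WORDED consequence: a class contained in the gauge-ratio conjunct at
  ONE window where the binders hold does not contain the dial; in particular no such dial inhabits the `∀`-window
  class `GaugeRatioClass τ = ⋂_w gaugeRatioAt τ w`.
* §6 `not_separates_of_strictGaugeRatio_subset` — the FINITE-STAGE WALL (instance of the cell's unconditional W2,
  `tally_not_separates_of_uniformlyRobust`): at finitely many windows the STRICT gauge-ratio class with `ζ` inside
  is `τ_unif`-robust at `ζ` (the ratio `|ε₁|/γ` is not a continuous reader, but its superlevel class is the
  positivity class of the continuous reader `τγ − |ε₁|`), hence separates `ζ` from the negatives of no domain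
  `⊇ arithDialSpace`.

## The `(Z)`-cell sentence this supports (for the carver; PROVED shape + per-window DATA binders)

ACCEPTED-WHILE-NEGATIVE ⟹ ARRIVAL CUSP: if a member `d = ζ + P` is accepted by the gauge-ratio conjunct at a window
`w` where `ζ` has a 2-cluster plane of height `η₂(w)` on which `P ≤ c`, and `P ≤ −p` on a vector of `ζ`-height `η`,
then `(p − η)(1 − τ) ≤ τ (η₂(w) + c)` (contrapositive of §3). Along windows where `η₂(w), η → 0` (DATA: `ζ`'s even
cluster, PF-N2) while the member's push persists (`p(w) ≥ p∞ > 0`, `c(w) ≤ c∞`; DATA: cluster profiles converge,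
PF-C7), acceptance requires `p∞ (1 − τ) ≤ τ c∞`: an upward push `≥ (1 − τ)/τ` times the downward one. Finite stages:
never separate (§6, unconditional). AS WORDED: no fixed dial with a persistent downward push on `ζ`'s cluster
inhabits (§5, conditional on the typed binders); the typed residue is "members whose effective push on `ζ`'s
cluster vanishes along the far windows".

References: R. Courant, D. Hilbert, Methods of Mathematical Physics I, §I.4 (min–max); the cell files
`PfPersistenceSecondLevel` (cand-3: `orthRayleighSet`, `exists_comb_dotProduct_eq_zero`),
`PfPersistenceSecondLevelWalls` (gauge Lipschitz law, W2 for gauge readers), `PfPersistenceDialLemma`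
(`evenBlock_dial_eq`), `PfPersistenceTallyW2` (the unconditional tally wall).
-/

set_option linter.dupNamespace false

noncomputable section

open Real Set Matrix

namespace Summit.RiemannHypothesis.RiemannHypothesis.Theorems.PfPersistence

/-! ## §1 A plane of Rayleigh height `≤ B` caps the second level -/

/-- PROVED: a nontrivial combination of two nonzero orthogonal vectors has positive self-product. [folklore] -/
theorem dotSelf_comb_pos {n : ℕ} {x y : Fin n → ℝ} (hx : x ≠ 0) (hy : y ≠ 0) (hxy : y ⬝ᵥ x = 0) {α β : ℝ}
    (hαβ : α ≠ 0 ∨ β ≠ 0) : 0 < (α • x + β • y) ⬝ᵥ (α • x + β • y) := by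
  have hxx : 0 < x ⬝ᵥ x := dotSelf_pos_of_ne_zero hx
  have hyy : 0 < y ⬝ᵥ y := dotSelf_pos_of_ne_zero hy
  rw [dotSelf_add_smul_of_orth hxy α β]
  rcases hαβ with hα | hβ
  · have := mul_pos (mul_self_pos.2 hα) hxx
    nlinarith [mul_nonneg (mul_self_nonneg β) hyy.le]
  · have := mul_pos (mul_self_pos.2 hβ) hyy
    nlinarith [mul_nonneg (mul_self_nonneg α) hxx.le]

/-- **PROVED — PLANE CAP ON THE SECOND LEVEL** (upper half of Courant–Fischer for `k = 2`, witness form; no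
symmetry): if the Rayleigh quotient is `≤ B` on the plane of two nonzero orthogonal vectors `x, y`, then
`ε₂(M) ≤ B` — every `u^⊥` meets the plane in a nonzero vector. [folklore] -/
theorem secondRayleigh_le_of_plane {n : ℕ} {M : Matrix (Fin (n + 1)) (Fin (n + 1)) ℝ} {x y : Fin (n + 1) → ℝ}
    (hx : x ≠ 0) (hy : y ≠ 0) (hxy : y ⬝ᵥ x = 0) {B : ℝ}
    (hB : ∀ α β : ℝ, (α • x + β • y) ⬝ᵥ (M *ᵥ (α • x + β • y)) ≤ B * ((α • x + β • y) ⬝ᵥ (α • x + β • y))) :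
    secondRayleigh M ≤ B := by
  rw [secondRayleigh_eq_iSup]
  refine ciSup_le fun u => ?_
  obtain ⟨α, β, hαβ, horth⟩ := exists_comb_dotProduct_eq_zero x y u
  have hvv : 0 < (α • x + β • y) ⬝ᵥ (α • x + β • y) := dotSelf_comb_pos hx hy hxy hαβ
  have hv : α • x + β • y ≠ 0 := by
    intro h
    rw [h, zero_dotProduct] at hvv
    exact lt_irrefl _ hvv
  refine (csInf_le (orthRayleighSet_bddBelow M u) ⟨_, hv, horth, rfl⟩).trans ?_
  rw [div_le_iff₀ hvv]
  exact hB α β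

/-! ## §2 Ratio rejection at the matrix level -/

/-- PROVED: an `m`-negative vector caps the bottom, `ε₁(M) ≤ −m`. [folklore] -/
theorem bottomRayleigh_le_neg_of_form {n : ℕ} {M : Matrix (Fin (n + 1)) (Fin (n + 1)) ℝ} {v : Fin (n + 1) → ℝ}
    (hv : v ≠ 0) {m : ℝ} (h : v ⬝ᵥ (M *ᵥ v) ≤ -m * (v ⬝ᵥ v)) : bottomRayleigh M ≤ -m :=
  (bottomRayleigh_le_rayleigh M hv).trans ((div_le_iff₀ (dotProduct_self_pos_of_ne_zero hv)).2 h)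

/-- **PROVED — GAUGE-RATIO REJECTION.** If `M` is `m`-negative (`vᵀMv ≤ −m vᵀv` for some `v ≠ 0`, `m > 0`), has a
plane of Rayleigh height `≤ B`, and `0 ≤ τ < 1` with `τ B < m (1 − τ)`, then the gauge-ratio conjunct FAILS:
`τ · (ε₂ − ε₁)(M) < |ε₁(M)|`. (The gauge is at most `B + |ε₁|`, the bottom at least `m` deep.) [folklore] -/
theorem mul_gauge_lt_abs_bottom {n : ℕ} {M : Matrix (Fin (n + 1)) (Fin (n + 1)) ℝ} {v : Fin (n + 1) → ℝ}
    (hv : v ≠ 0) {m : ℝ} (hm : 0 < m) (hneg : v ⬝ᵥ (M *ᵥ v) ≤ -m * (v ⬝ᵥ v)) {x y : Fin (n + 1) → ℝ}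
    (hx : x ≠ 0) (hy : y ≠ 0) (hxy : y ⬝ᵥ x = 0) {B : ℝ}
    (hB : ∀ α β : ℝ, (α • x + β • y) ⬝ᵥ (M *ᵥ (α • x + β • y)) ≤ B * ((α • x + β • y) ⬝ᵥ (α • x + β • y)))
    {τ : ℝ} (hτ0 : 0 ≤ τ) (hτ : τ < 1) (hmargin : τ * B < m * (1 - τ)) :
    τ * (secondRayleigh M - bottomRayleigh M) < |bottomRayleigh M| := by
  have h1 : bottomRayleigh M ≤ -m := bottomRayleigh_le_neg_of_form hv hneg
  have h2 : secondRayleigh M ≤ B := secondRayleigh_le_of_plane hx hy hxy hB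
  rw [abs_of_neg (by linarith)]
  have h3 : τ * secondRayleigh M ≤ τ * B := mul_le_mul_of_nonneg_left h2 hτ0
  have h4 : bottomRayleigh M * (1 - τ) ≤ -m * (1 - τ) := mul_le_mul_of_nonneg_right h1 (by linarith)
  nlinarith

/-- **PROVED — MODULUS-RATIO REJECTION** (dimension `≥ 2`). If `M` is `m`-negative, has a plane of height `≤ B`,
and `0 ≤ κ < 1` with `κ B < m`, then `κ · |ε₂(M)| < |ε₁(M)|` (cand-11's I1 reads `g₁ < 1 − κ`). If `ε₂ < 0` the
inequality is automatic from `ε₁ ≤ ε₂ < 0`; else `|ε₂| = ε₂ ≤ B`. [folklore] -/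
theorem mul_abs_second_lt_abs_bottom {n : ℕ} (hn : 0 < n) {M : Matrix (Fin (n + 1)) (Fin (n + 1)) ℝ}
    {v : Fin (n + 1) → ℝ} (hv : v ≠ 0) {m : ℝ} (hm : 0 < m) (hneg : v ⬝ᵥ (M *ᵥ v) ≤ -m * (v ⬝ᵥ v))
    {x y : Fin (n + 1) → ℝ} (hx : x ≠ 0) (hy : y ≠ 0) (hxy : y ⬝ᵥ x = 0) {B : ℝ}
    (hB : ∀ α β : ℝ, (α • x + β • y) ⬝ᵥ (M *ᵥ (α • x + β • y)) ≤ B * ((α • x + β • y) ⬝ᵥ (α • x + β • y)))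
    {κ : ℝ} (hκ0 : 0 ≤ κ) (hκ : κ < 1) (hmargin : κ * B < m) :
    κ * |secondRayleigh M| < |bottomRayleigh M| := by
  have h1 : bottomRayleigh M ≤ -m := bottomRayleigh_le_neg_of_form hv hneg
  have h2 : secondRayleigh M ≤ B := secondRayleigh_le_of_plane hx hy hxy hB
  have h12 : bottomRayleigh M ≤ secondRayleigh M := bottomRayleigh_le_secondRayleigh hn M
  rw [abs_of_neg (show bottomRayleigh M < 0 by linarith)]
  by_cases hpos₂ : 0 ≤ secondRayleigh M
  · rw [abs_of_nonneg hpos₂]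
    nlinarith
  · rw [abs_of_neg (not_le.1 hpos₂)]
    nlinarith [not_le.1 hpos₂]

/-! ## §3 Rejection against a 2-cluster of a reference matrix (`ζ`'s window matrix) -/

/-- **PROVED — REJECTION BY A 2-CLUSTER BELOW THE PUSH.** Write the member's matrix as `Z + P`. BINDERS: a plane
`{x, y}` (nonzero, orthogonal) of `Z`-height `≤ η₂` on which the push is capped, `vᵀPv ≤ c vᵀv`; one vector
`v₀ ≠ 0` of `Z`-height `≤ η` pushed down by `p`, `v₀ᵀPv₀ ≤ −p v₀ᵀv₀`, with `η < p`. Then for every `0 ≤ τ < 1` with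
`τ (η₂ + c) < (p − η)(1 − τ)` the gauge-ratio conjunct fails for `Z + P`: `τ · (ε₂ − ε₁) < |ε₁|`. [folklore] -/
theorem mul_gauge_lt_abs_bottom_of_push {n : ℕ} {Z P : Matrix (Fin (n + 1)) (Fin (n + 1)) ℝ}
    {x y : Fin (n + 1) → ℝ} (hx : x ≠ 0) (hy : y ≠ 0) (hxy : y ⬝ᵥ x = 0) {η₂ c : ℝ}
    (hZ : ∀ α β : ℝ, (α • x + β • y) ⬝ᵥ (Z *ᵥ (α • x + β • y)) ≤ η₂ * ((α • x + β • y) ⬝ᵥ (α • x + β • y)))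
    (hP : ∀ α β : ℝ, (α • x + β • y) ⬝ᵥ (P *ᵥ (α • x + β • y)) ≤ c * ((α • x + β • y) ⬝ᵥ (α • x + β • y)))
    {v₀ : Fin (n + 1) → ℝ} (hv₀ : v₀ ≠ 0) {η p : ℝ} (hηp : η < p) (hZv : v₀ ⬝ᵥ (Z *ᵥ v₀) ≤ η * (v₀ ⬝ᵥ v₀))
    (hPv : v₀ ⬝ᵥ (P *ᵥ v₀) ≤ -p * (v₀ ⬝ᵥ v₀)) {τ : ℝ} (hτ0 : 0 ≤ τ) (hτ : τ < 1)
    (hmargin : τ * (η₂ + c) < (p - η) * (1 - τ)) :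
    τ * (secondRayleigh (Z + P) - bottomRayleigh (Z + P)) < |bottomRayleigh (Z + P)| := by
  refine mul_gauge_lt_abs_bottom hv₀ (sub_pos.2 hηp) ?_ hx hy hxy (B := η₂ + c) ?_ hτ0 hτ hmargin
  · rw [add_mulVec, dotProduct_add]
    nlinarith
  · intro α β
    rw [add_mulVec, dotProduct_add]
    have := hZ α β
    have := hP α β
    nlinarith

/-- **PROVED — MODULUS-RATIO VERSION** of the 2-cluster rejection (dimension `≥ 2`): with the same binders and
`0 ≤ κ < 1`, `κ (η₂ + c) < p − η` gives `κ · |ε₂(Z + P)| < |ε₁(Z + P)|`. [folklore] -/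
theorem mul_abs_second_lt_abs_bottom_of_push {n : ℕ} (hn : 0 < n) {Z P : Matrix (Fin (n + 1)) (Fin (n + 1)) ℝ}
    {x y : Fin (n + 1) → ℝ} (hx : x ≠ 0) (hy : y ≠ 0) (hxy : y ⬝ᵥ x = 0) {η₂ c : ℝ}
    (hZ : ∀ α β : ℝ, (α • x + β • y) ⬝ᵥ (Z *ᵥ (α • x + β • y)) ≤ η₂ * ((α • x + β • y) ⬝ᵥ (α • x + β • y)))
    (hP : ∀ α β : ℝ, (α • x + β • y) ⬝ᵥ (P *ᵥ (α • x + β • y)) ≤ c * ((α • x + β • y) ⬝ᵥ (α • x + β • y)))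
    {v₀ : Fin (n + 1) → ℝ} (hv₀ : v₀ ≠ 0) {η p : ℝ} (hηp : η < p) (hZv : v₀ ⬝ᵥ (Z *ᵥ v₀) ≤ η * (v₀ ⬝ᵥ v₀))
    (hPv : v₀ ⬝ᵥ (P *ᵥ v₀) ≤ -p * (v₀ ⬝ᵥ v₀)) {κ : ℝ} (hκ0 : 0 ≤ κ) (hκ : κ < 1)
    (hmargin : κ * (η₂ + c) < p - η) :
    κ * |secondRayleigh (Z + P)| < |bottomRayleigh (Z + P)| := by
  refine mul_abs_second_lt_abs_bottom hn hv₀ (sub_pos.2 hηp) ?_ hx hy hxy (B := η₂ + c) ?_ hκ0 hκ hmargin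
  · rw [add_mulVec, dotProduct_add]
    nlinarith
  · intro α β
    rw [add_mulVec, dotProduct_add]
    have := hZ α β
    have := hP α β
    nlinarith

/-! ## §4 The conjuncts as classes of data; the dial instance -/

/-- the GAUGE-RATIO CONJUNCT at window `win` with ratio `τ`: `|ε₁(d; win)| ≤ τ · (ε₂ − ε₁)(d; win)` — sign-blind,
`R1`-free ("the bottom sits within `τ` of the cluster scale"; leaf G1.21b's scale conjunct). [folklore] -/
def gaugeRatioAt (τ : ℝ) (win : Window) : Set Datum :=
  {d | |bottomRayleigh (d win)| ≤ τ * bottomGapGauge d win}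

/-- the MODULUS-RATIO CONJUNCT at window `win`: `|ε₁(d; win)| ≤ κ · |ε₂(d; win)|` (cand-11's instrument I1,
`g₁ = 1 − |ε₁/ε₂| ≥ 1 − κ`). [folklore] -/
def modulusRatioAt (κ : ℝ) (win : Window) : Set Datum :=
  {d | |bottomRayleigh (d win)| ≤ κ * |secondRayleigh (d win)|}

/-- the `∀`-WINDOW (AS-WORDED) gauge-ratio class `⋂_w gaugeRatioAt τ w`. [folklore] -/
def GaugeRatioClass (τ : ℝ) : Set Datum := {d | ∀ win, d ∈ gaugeRatioAt τ win}

/-- PROVED: the AS-WORDED class lies in each of its window conjuncts. [folklore] -/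
theorem gaugeRatioClass_subset (τ : ℝ) (win : Window) : GaugeRatioClass τ ⊆ gaugeRatioAt τ win :=
  fun _ hd => hd win

/-- PROVED (the dial's window form): at a window reaching `q`, the `q`-dial `K` of `ζ` has form
`vᵀζ_w v − t · vᵀΘ_q v` with `t = 2 (K − 1) w(q)` (`evenBlock_dial_eq`). [folklore] -/
theorem form_dial_zeta {q : ℕ} {win : Window} (hq : q ∈ primeRange (2 * win.a)) (K : ℝ)
    (v : Fin (win.N + 1) → ℝ) :
    v ⬝ᵥ (datumOf (dial q K zetaWeights) win *ᵥ v)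
      = v ⬝ᵥ (zetaDatum win *ᵥ v) - 2 * (K - 1) * zetaWeights q * (v ⬝ᵥ (primePattern q win *ᵥ v)) := by
  show v ⬝ᵥ (evenBlock (dial q K zetaWeights) win *ᵥ v) = v ⬝ᵥ (evenBlock zetaWeights win *ᵥ v) - _
  rw [evenBlock_dial_eq hq, rayleigh_sub_smul]

/-- PROVED (the dial's window matrix as reference plus push): `(dial)_w = ζ_w + (−t • Θ_q)`. [folklore] -/
theorem datumOf_dial_zeta_eq_add {q : ℕ} {win : Window} (hq : q ∈ primeRange (2 * win.a)) (K : ℝ) :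
    datumOf (dial q K zetaWeights) win
      = zetaDatum win + (-(2 * (K - 1) * zetaWeights q)) • primePattern q win := by
  show evenBlock (dial q K zetaWeights) win = evenBlock zetaWeights win + _
  rw [evenBlock_dial_eq hq, neg_smul, sub_eq_add_neg]

/-- **PROVED — THE DIAL INSTANCE (gauge ratio).** At a window `w` reaching `q`, let `t = 2 (K − 1) w(q)`. BINDERS
(per-window, sign-blind, engine-certifiable): a plane `{x, y}` of `ζ`-height `≤ η₂` on which `−t · Θ_q ≤ c`;
a vector `v₀ ≠ 0` of `ζ`-height `≤ η` with `t · v₀ᵀΘ_q v₀ ≥ p v₀ᵀv₀`, `η < p`. Then for `0 ≤ τ < 1` with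
`τ (η₂ + c) < (p − η)(1 − τ)` the `q`-dial `K` of `ζ` is NOT in the gauge-ratio conjunct at `w`. [folklore] -/
theorem dial_not_mem_gaugeRatioAt {q : ℕ} {win : Window} (hq : q ∈ primeRange (2 * win.a)) {K : ℝ}
    {x y : Fin (win.N + 1) → ℝ} (hx : x ≠ 0) (hy : y ≠ 0) (hxy : y ⬝ᵥ x = 0) {η₂ c : ℝ}
    (hZ : ∀ α β : ℝ, (α • x + β • y) ⬝ᵥ (zetaDatum win *ᵥ (α • x + β • y))
      ≤ η₂ * ((α • x + β • y) ⬝ᵥ (α • x + β • y)))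
    (hP : ∀ α β : ℝ, -(2 * (K - 1) * zetaWeights q) * ((α • x + β • y) ⬝ᵥ (primePattern q win *ᵥ (α • x + β • y)))
      ≤ c * ((α • x + β • y) ⬝ᵥ (α • x + β • y)))
    {v₀ : Fin (win.N + 1) → ℝ} (hv₀ : v₀ ≠ 0) {η p : ℝ} (hηp : η < p)
    (hZv : v₀ ⬝ᵥ (zetaDatum win *ᵥ v₀) ≤ η * (v₀ ⬝ᵥ v₀))
    (hPv : p * (v₀ ⬝ᵥ v₀) ≤ 2 * (K - 1) * zetaWeights q * (v₀ ⬝ᵥ (primePattern q win *ᵥ v₀)))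
    {τ : ℝ} (hτ0 : 0 ≤ τ) (hτ : τ < 1) (hmargin : τ * (η₂ + c) < (p - η) * (1 - τ)) :
    datumOf (dial q K zetaWeights) ∉ gaugeRatioAt τ win := by
  intro hmem
  simp only [gaugeRatioAt, mem_setOf_eq, bottomGapGauge] at hmem
  rw [datumOf_dial_zeta_eq_add hq] at hmem
  refine absurd hmem (not_le.2 (mul_gauge_lt_abs_bottom_of_push hx hy hxy hZ ?_ hv₀ hηp hZv ?_ hτ0 hτ hmargin))
  · intro α β
    rw [Matrix.smul_mulVec, dotProduct_smul, smul_eq_mul]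
    exact hP α β
  · rw [Matrix.smul_mulVec, dotProduct_smul, smul_eq_mul]
    linarith

/-- **PROVED — THE DIAL INSTANCE (modulus ratio, dimension `≥ 2`):** same binders, `0 ≤ κ < 1`,
`κ (η₂ + c) < p − η` ⟹ the `q`-dial `K` of `ζ` is NOT in the modulus-ratio conjunct at `w`. [folklore] -/
theorem dial_not_mem_modulusRatioAt {q : ℕ} {win : Window} (hN : 0 < win.N) (hq : q ∈ primeRange (2 * win.a))
    {K : ℝ} {x y : Fin (win.N + 1) → ℝ} (hx : x ≠ 0) (hy : y ≠ 0) (hxy : y ⬝ᵥ x = 0) {η₂ c : ℝ}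
    (hZ : ∀ α β : ℝ, (α • x + β • y) ⬝ᵥ (zetaDatum win *ᵥ (α • x + β • y))
      ≤ η₂ * ((α • x + β • y) ⬝ᵥ (α • x + β • y)))
    (hP : ∀ α β : ℝ, -(2 * (K - 1) * zetaWeights q) * ((α • x + β • y) ⬝ᵥ (primePattern q win *ᵥ (α • x + β • y)))
      ≤ c * ((α • x + β • y) ⬝ᵥ (α • x + β • y)))
    {v₀ : Fin (win.N + 1) → ℝ} (hv₀ : v₀ ≠ 0) {η p : ℝ} (hηp : η < p)
    (hZv : v₀ ⬝ᵥ (zetaDatum win *ᵥ v₀) ≤ η * (v₀ ⬝ᵥ v₀))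
    (hPv : p * (v₀ ⬝ᵥ v₀) ≤ 2 * (K - 1) * zetaWeights q * (v₀ ⬝ᵥ (primePattern q win *ᵥ v₀)))
    {κ : ℝ} (hκ0 : 0 ≤ κ) (hκ : κ < 1) (hmargin : κ * (η₂ + c) < p - η) :
    datumOf (dial q K zetaWeights) ∉ modulusRatioAt κ win := by
  intro hmem
  simp only [modulusRatioAt, mem_setOf_eq] at hmem
  rw [datumOf_dial_zeta_eq_add hq] at hmem
  refine absurd hmem (not_le.2
    (mul_abs_second_lt_abs_bottom_of_push hN hx hy hxy hZ ?_ hv₀ hηp hZv ?_ hκ0 hκ hmargin))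
  · intro α β
    rw [Matrix.smul_mulVec, dotProduct_smul, smul_eq_mul]
    exact hP α β
  · rw [Matrix.smul_mulVec, dotProduct_smul, smul_eq_mul]
    linarith

/-! ## §5 AS WORDED: one rejecting window excludes the member from every class inside the conjunct -/

/-- **PROVED — AS-WORDED NON-INHABITATION (conditional on the typed binders at ONE window).** If a class `S` lies
inside the gauge-ratio conjunct at a window where the binders of `dial_not_mem_gaugeRatioAt` hold, then the dial is
not in `S`. With `S = GaugeRatioClass τ` (via `gaugeRatioClass_subset`): a dial whose downward push on `ζ`'s
cluster persists while `ζ`'s 2-cluster height tends to `0` is rejected at every deep window — acceptance while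
negative is confined to the ARRIVAL CUSP `(p − η)(1 − τ) ≤ τ (η₂ + c)`. The W2 door (small negative dials inside
the class) is thereby CLOSED for AS-WORDED ratio classes up to the typed residue "members with vanishing
effective push on `ζ`'s cluster". [folklore] -/
theorem dial_not_mem_of_subset_gaugeRatioAt {S : Set Datum} {τ : ℝ} {win : Window} (hS : S ⊆ gaugeRatioAt τ win)
    {q : ℕ} (hq : q ∈ primeRange (2 * win.a)) {K : ℝ} {x y : Fin (win.N + 1) → ℝ} (hx : x ≠ 0) (hy : y ≠ 0)
    (hxy : y ⬝ᵥ x = 0) {η₂ c : ℝ}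
    (hZ : ∀ α β : ℝ, (α • x + β • y) ⬝ᵥ (zetaDatum win *ᵥ (α • x + β • y))
      ≤ η₂ * ((α • x + β • y) ⬝ᵥ (α • x + β • y)))
    (hP : ∀ α β : ℝ, -(2 * (K - 1) * zetaWeights q) * ((α • x + β • y) ⬝ᵥ (primePattern q win *ᵥ (α • x + β • y)))
      ≤ c * ((α • x + β • y) ⬝ᵥ (α • x + β • y)))
    {v₀ : Fin (win.N + 1) → ℝ} (hv₀ : v₀ ≠ 0) {η p : ℝ} (hηp : η < p)
    (hZv : v₀ ⬝ᵥ (zetaDatum win *ᵥ v₀) ≤ η * (v₀ ⬝ᵥ v₀))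
    (hPv : p * (v₀ ⬝ᵥ v₀) ≤ 2 * (K - 1) * zetaWeights q * (v₀ ⬝ᵥ (primePattern q win *ᵥ v₀)))
    (hτ0 : 0 ≤ τ) (hτ : τ < 1) (hmargin : τ * (η₂ + c) < (p - η) * (1 - τ)) :
    datumOf (dial q K zetaWeights) ∉ S :=
  fun h => dial_not_mem_gaugeRatioAt hq hx hy hxy hZ hP hv₀ hηp hZv hPv hτ0 hτ hmargin (hS h)

/-- **PROVED — THE ARRIVAL CUSP (contrapositive, the quotable inequality).** If the dial IS accepted by the
gauge-ratio conjunct at a window where the cluster binders hold (`0 ≤ τ < 1`), then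
`(p − η)(1 − τ) ≤ τ (η₂ + c)`: its net negativity depth is at most `τ/(1 − τ)` times (`ζ`'s 2-cluster height plus
its upward push on the cluster plane). [folklore] -/
theorem arrival_cusp_of_mem_gaugeRatioAt {q : ℕ} {win : Window} (hq : q ∈ primeRange (2 * win.a)) {K : ℝ}
    {x y : Fin (win.N + 1) → ℝ} (hx : x ≠ 0) (hy : y ≠ 0) (hxy : y ⬝ᵥ x = 0) {η₂ c : ℝ}
    (hZ : ∀ α β : ℝ, (α • x + β • y) ⬝ᵥ (zetaDatum win *ᵥ (α • x + β • y))
      ≤ η₂ * ((α • x + β • y) ⬝ᵥ (α • x + β • y)))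
    (hP : ∀ α β : ℝ, -(2 * (K - 1) * zetaWeights q) * ((α • x + β • y) ⬝ᵥ (primePattern q win *ᵥ (α • x + β • y)))
      ≤ c * ((α • x + β • y) ⬝ᵥ (α • x + β • y)))
    {v₀ : Fin (win.N + 1) → ℝ} (hv₀ : v₀ ≠ 0) {η p : ℝ} (hηp : η < p)
    (hZv : v₀ ⬝ᵥ (zetaDatum win *ᵥ v₀) ≤ η * (v₀ ⬝ᵥ v₀))
    (hPv : p * (v₀ ⬝ᵥ v₀) ≤ 2 * (K - 1) * zetaWeights q * (v₀ ⬝ᵥ (primePattern q win *ᵥ v₀)))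
    {τ : ℝ} (hτ0 : 0 ≤ τ) (hτ : τ < 1) (hmem : datumOf (dial q K zetaWeights) ∈ gaugeRatioAt τ win) :
    (p - η) * (1 - τ) ≤ τ * (η₂ + c) :=
  not_lt.1 fun h => dial_not_mem_gaugeRatioAt hq hx hy hxy hZ hP hv₀ hηp hZv hPv hτ0 hτ h hmem

/-! ## §6 The finite-stage wall: strict gauge-ratio classes at finitely many windows are `τ_unif`-robust at `ζ` -/

/-- **PROVED — ROBUSTNESS OF THE STRICT FINITE GAUGE-RATIO CLASS.** At finitely many windows of dimension `≥ 2`,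
if `ζ` satisfies the conjuncts STRICTLY, `|ε₁(ζ; W i)| < τ i · γ(ζ; W i)` with `τ i ≥ 0`, then the class
`{d | ∀ i, |ε₁(d; W i)| < τ i · γ(d; W i)}` contains a `τ_unif`-ball around `ζ` (Lipschitz laws of `ε₁` and of the
gauge). The ratio itself is no continuous reader; its strict superlevel class is the positivity class of the
continuous reader `τγ − |ε₁|`. [folklore] -/
theorem uniformlyRobustAt_strictGaugeRatio {k : ℕ} (W : Fin k → Window) (hW : ∀ i, 0 < (W i).N) {τ : Fin k → ℝ}
    (hτ : ∀ i, 0 ≤ τ i)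
    (hζ : ∀ i, |bottomRayleigh (zetaDatum (W i))| < τ i * bottomGapGauge zetaDatum (W i)) :
    UniformlyRobustAt {d | ∀ i, |bottomRayleigh (d (W i))| < τ i * bottomGapGauge d (W i)} zetaDatum := by
  -- margins `μ i > 0` and one tolerance `ε` with `2ε/μ i ≤ 1/(2T + 2)`, `T = Σ τ i ≥ τ i`
  set T : ℝ := ∑ j, τ j with hT_def
  have hTi : ∀ i, τ i ≤ T := fun i =>
    Finset.single_le_sum (f := τ) (fun j _ => hτ j) (Finset.mem_univ i)
  have hT : 0 ≤ T := Finset.sum_nonneg fun j _ => hτ j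
  obtain ⟨ε, hε, hle⟩ := exists_eps_forall_le
    (γ := fun i => τ i * bottomGapGauge zetaDatum (W i) - |bottomRayleigh (zetaDatum (W i))|)
    (fun i => sub_pos.2 (hζ i)) (show (0 : ℝ) < 1 / (2 * T + 2) by positivity)
  refine ⟨ε, hε, fun d hd i => ?_⟩
  have hμ : 0 < τ i * bottomGapGauge zetaDatum (W i) - |bottomRayleigh (zetaDatum (W i))| := sub_pos.2 (hζ i)
  have h1 := abs_bottomGapGauge_sub_le_of_uniformlyClose hd (W i) (hW i)
  have h2 := abs_bottomRayleigh_sub_le_of_uniformlyClose hd (W i)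
  have h3 := hle i
  rw [div_le_iff₀ hμ] at h3
  rw [abs_le] at h1 h2
  -- `| |ε₁(d)| − |ε₁(ζ)| | ≤ ε` and `τ i |γ(d) − γ(ζ)| ≤ 2 τ i ε`
  have h4 : |bottomRayleigh (d (W i))| ≤ |bottomRayleigh (zetaDatum (W i))| + ε := by
    have := abs_sub_abs_le_abs_sub (bottomRayleigh (d (W i))) (bottomRayleigh (zetaDatum (W i)))
    have h2' : |bottomRayleigh (d (W i)) - bottomRayleigh (zetaDatum (W i))| ≤ ε := by
      rw [abs_sub_comm, abs_le]; exact ⟨by linarith [h2.2], by linarith [h2.1]⟩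
    linarith
  have h5 : τ i * bottomGapGauge zetaDatum (W i) - τ i * (2 * ε) ≤ τ i * bottomGapGauge d (W i) := by
    have := mul_le_mul_of_nonneg_left (show bottomGapGauge zetaDatum (W i) - 2 * ε ≤ bottomGapGauge d (W i) by
      linarith [h1.2]) (hτ i)
    linarith [this]
  have h6 : (2 * τ i + 1) * ε < τ i * bottomGapGauge zetaDatum (W i) - |bottomRayleigh (zetaDatum (W i))| := by
    have hTi' := hTi i
    have : 2 * ε * (2 * T + 2) ≤ τ i * bottomGapGauge zetaDatum (W i) - |bottomRayleigh (zetaDatum (W i))| := by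
      have := h3; field_simp at this; linarith [this]
    nlinarith
  show |bottomRayleigh (d (W i))| < τ i * bottomGapGauge d (W i)
  nlinarith [hτ i]

/-- **PROVED — WALL W2 FOR STRICT GAUGE-RATIO CLASSES AT FINITELY MANY WINDOWS, UNCONDITIONAL:** a class
containing `{d | ∀ i, |ε₁(d; W i)| < τ i · γ(d; W i)}` (dimension `≥ 2`, `τ i ≥ 0`, `ζ` strictly inside) separates
`ζ` from the detectably negative data of no domain `⊇ arithDialSpace` (the cell's tally wall). Finite stages of the
`(Z)`-cell never separate; §5 is what happens AS WORDED. [folklore] -/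
theorem not_separates_of_strictGaugeRatio_subset {k : ℕ} (W : Fin k → Window) (hW : ∀ i, 0 < (W i).N)
    {τ : Fin k → ℝ} (hτ : ∀ i, 0 ≤ τ i)
    (hζ : ∀ i, |bottomRayleigh (zetaDatum (W i))| < τ i * bottomGapGauge zetaDatum (W i)) {S D : Set Datum}
    (hS : {d | ∀ i, |bottomRayleigh (d (W i))| < τ i * bottomGapGauge d (W i)} ⊆ S) (hD : arithDialSpace ⊆ D) :
    ¬ Separates S D zetaDatum := by
  obtain ⟨ε, hε, h⟩ := uniformlyRobustAt_strictGaugeRatio W hW hτ hζ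
  exact tally_not_separates_of_uniformlyRobust hD ⟨ε, hε, fun d hd => hS (h d hd)⟩

/-- PROVED (bookkeeping for the carver): the rejected dial is an ARITHMETIC member, so §5 speaks about the tally
domain `arithDialSpace` of the barrier conjecture. [folklore] -/
theorem dial_mem_arithDialSpace_and_not_mem {S : Set Datum} {τ : ℝ} {win : Window} (hS : S ⊆ gaugeRatioAt τ win)
    {q : ℕ} (hq : q ∈ primeRange (2 * win.a)) {K : ℝ} {x y : Fin (win.N + 1) → ℝ} (hx : x ≠ 0) (hy : y ≠ 0)
    (hxy : y ⬝ᵥ x = 0) {η₂ c : ℝ}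
    (hZ : ∀ α β : ℝ, (α • x + β • y) ⬝ᵥ (zetaDatum win *ᵥ (α • x + β • y))
      ≤ η₂ * ((α • x + β • y) ⬝ᵥ (α • x + β • y)))
    (hP : ∀ α β : ℝ, -(2 * (K - 1) * zetaWeights q) * ((α • x + β • y) ⬝ᵥ (primePattern q win *ᵥ (α • x + β • y)))
      ≤ c * ((α • x + β • y) ⬝ᵥ (α • x + β • y)))
    {v₀ : Fin (win.N + 1) → ℝ} (hv₀ : v₀ ≠ 0) {η p : ℝ} (hηp : η < p)
    (hZv : v₀ ⬝ᵥ (zetaDatum win *ᵥ v₀) ≤ η * (v₀ ⬝ᵥ v₀))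
    (hPv : p * (v₀ ⬝ᵥ v₀) ≤ 2 * (K - 1) * zetaWeights q * (v₀ ⬝ᵥ (primePattern q win *ᵥ v₀)))
    (hτ0 : 0 ≤ τ) (hτ : τ < 1) (hmargin : τ * (η₂ + c) < (p - η) * (1 - τ)) :
    datumOf (dial q K zetaWeights) ∈ arithDialSpace ∧ datumOf (dial q K zetaWeights) ∉ S :=
  ⟨datumOf_dial_zeta_mem_arithDialSpace q K,
    dial_not_mem_of_subset_gaugeRatioAt hS hq hx hy hxy hZ hP hv₀ hηp hZv hPv hτ0 hτ hmargin⟩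

end Summit.RiemannHypothesis.RiemannHypothesis.Theorems.PfPersistence

end
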